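import Mathlib
import HarnessLib

/-!
# Route `F4SubCurvatureDoor`, crux stmt-QuantumFields-23125 `RationalToGeneral` — the route owner's HEXAGON NORMAL FORM objects
# (crux idea `hexagon-normal-form`): typed statements, nothing asserted

D-0016 `<Route><Piece>Defs` file (objects a crux idea of the route posits; reviewed; NOTHING is asserted — every declaration is a
`def`, the conjecture included).  CHARACTER-IDENTICAL to the owner's typed sketch `l15/HexagonSketch.lean` (planner `ym-idea-3`
g15, crux idea card `hexagon-normal-form` = evidence #5 on stmt-QuantumFields-23125; critic idea-crit-4 g5 19:19:33Z: "dossier material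
for 23125's next taker"), so that the card and its support lemmas have tree names:

* `P s w = (w − 2s)(w² − 16sw + 16s²)` — the Wick-plane image of `u₆` at spatial momentum `s = q²` (`P_s(w) − w³ = −2s(3w−4s)²`);
* `IsRealEntire F` — entire and commuting with complex conjugation;
* `WickHexagon F G` — the Wick condition on one 60° (short-root) plane for a finite-type shell function `Ψ = F(u₂) + u₆G(u₂)`:
  for every `s ≥ 0` all zeros of `Φ_s = F + P_s G` are real and `≤ s`;
* `GrowthO3` — (O3), the card's typed FIRST LEMMA: forbidden zeros at `w > s` force `x³‖G x‖ ≤ ‖F x‖` on the positive axis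
  (PROVED in the companion `F4SubCurvatureDoorHexagonGrowthO3.lean`);
* `RealRootedO2` — (O2): `G` is real-rooted (Hurwitz; open in the tree);
* `FiniteTypeHexagon` — the FINITE-TYPE HEXAGON CONJECTURE in the order-`< 1` class (OPEN; a `def`, not asserted);
* `WickSquare F G` / `SquareAnalogueFails` — the square (`W(B₄)`, 90°) contrast: the analogue of `WickHexagon` with the multiplier
  `w² − 8sw + 8s²` admits a non-trivial pair (PROVED in the companion `F4SubCurvatureDoorHexagonSquareContrast.lean`).

Honest framing: definitions only; the conjecture `FiniteTypeHexagon`, the crux 23125, the route's rung (`BalabanLadder.ROT`) and every summit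
statement are untouched.  Landed by seat `ym-line-frs-p2` g9 (free hands, announced on the owner's bus 2026-08-28T19:20Z),
`--supports stmt-QuantumFields-23125`.
-/

open ComplexConjugate

namespace Summit.QuantumFields.YangMills.Cruxes.RationalToGeneral.HexagonNormalForm

/-- the Wick-plane image of `u₆` at spatial momentum `s = q²`: `P_s(w) = (w − 2s)(w² − 16sw + 16s²) = w³ − 2s(3w − 4s)² + …`,
    precisely `P_s(w) − w³ = −2s(3w−4s)²`. [problem-side definition] -/
noncomputable def P (s : ℝ) (w : ℂ) : ℂ := (w - 2 * (s : ℂ)) * (w ^ 2 - 16 * (s : ℂ) * w + 16 * (s : ℂ) ^ 2)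

/-- a real entire function (entire, commuting with complex conjugation). [problem-side definition] -/
def IsRealEntire (F : ℂ → ℂ) : Prop := Differentiable ℂ F ∧ ∀ z, F (conj z) = conj (F z)

/-- the Wick condition on one 60° plane for a finite-type shell function `Ψ = F(u₂) + u₆ G(u₂)`:
    for every `s ≥ 0`, all zeros of `Φ_s = F + P_s G` are real and `≤ s`. [problem-side definition] -/
def WickHexagon (F G : ℂ → ℂ) : Prop :=
  ∀ s : ℝ, 0 ≤ s → ∀ z : ℂ, F z + P s z * G z = 0 → z.im = 0 ∧ z.re ≤ s

/-- (O3), the typed FIRST LEMMA of the line: forbidden zeros at `w > s` force `|F| ≥ w³ |G|` along the positive axis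
    (proof on paper: `s ↦ P_s(w)` covers `(−w³, w³]` on `s ∈ [0, w)`, intermediate value theorem). [problem-side definition] -/
def GrowthO3 : Prop :=
  ∀ F G : ℂ → ℂ, IsRealEntire F → IsRealEntire G → WickHexagon F G →
    ∀ x : ℝ, 0 < x → x ^ 3 * ‖G (x : ℂ)‖ ≤ ‖F (x : ℂ)‖

/-- (O2): `G` is real-rooted (Hurwitz as `s → ∞`, since `Φ_s / (−32 s³) → G` locally uniformly). [problem-side definition] -/
def RealRootedO2 : Prop :=
  ∀ F G : ℂ → ℂ, IsRealEntire F → IsRealEntire G → WickHexagon F G → ∀ z : ℂ, G z = 0 → z.im = 0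

/-- the FINITE-TYPE HEXAGON CONJECTURE (support radiality for one anisotropic layer), stated in the order-`< 1` class where the
    memo proposes to finish it: real entire `F, G` of growth `≤ exp(C |z|^{1/2})`-type… here typed with an explicit order bound `ρ < 1`.
    OPEN — a `def`, not asserted anywhere. [problem-side definition] -/
def FiniteTypeHexagon : Prop :=
  ∀ F G : ℂ → ℂ, IsRealEntire F → IsRealEntire G →
    (∃ ρ C : ℝ, ρ < 1 ∧ ∀ z : ℂ, ‖F z‖ ≤ Real.exp (C * (1 + ‖z‖) ^ ρ) ∧ ‖G z‖ ≤ Real.exp (C * (1 + ‖z‖) ^ ρ)) →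
    WickHexagon F G → ∀ z, G z = 0

/-- the SQUARE (W(B₄), 90°) analogue is FALSE — Prop. B in one variable: `F = (3/2)w² + 3w + 2`, `G = −1/2`,
    `Φ_s = w² + (3+4s)w + 2 − 4s²` has discriminant `32s² + 24s + 1 > 0`. Recorded as the statement to refute, for contrast.
    [problem-side definition] -/
def WickSquare (F G : ℂ → ℂ) : Prop :=
  ∀ s : ℝ, 0 ≤ s → ∀ z : ℂ, F z + (z ^ 2 - 8 * (s : ℂ) * z + 8 * (s : ℂ) ^ 2) * G z = 0 → z.im = 0 ∧ z.re ≤ s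

/-- the square contrast: a non-trivial real-entire pair satisfying `WickSquare` exists (PROVED in the companion file).
    [problem-side definition] -/
def SquareAnalogueFails : Prop :=
  ∃ F G : ℂ → ℂ, IsRealEntire F ∧ IsRealEntire G ∧ WickSquare F G ∧ ∃ z, G z ≠ 0

end Summit.QuantumFields.YangMills.Cruxes.RationalToGeneral.HexagonNormalForm
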